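import Summits.CriticalPhenomena.PercolationContinuityZ3.Theorems.SahiDisjointSlot
import Literature.Combinatorics.Sahi2008.Multilinear
import Literature.Combinatorics.Sahi2008.IndependentAtoms
import Literature.Combinatorics.Sahi2008.Symmetry
import Literature.Combinatorics.Sahi2008.IndependentSplitting
import Literature.Combinatorics.Sahi2008.UniformSquareAllOrders

/-!
# `NoHeavyLowerTail` (crux stmt-CriticalPhenomena-4575), Sahi programme: census identities, part 2 —
# absorbed slots (L1, L-thin, the absorbed free slot, the L3-frame multipliers `r = 1, 2`), every `n`

Support file (Sahi cell; `--supports stmt-CriticalPhenomena-4575`).  Mathematics and Lean text by the census seat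
`prim-sahi-census` gen 4 (HOME/prim-sahi-census/HandoffIdentitiesG4.lean, rc 0, 2026-08-20), landed verbatim by the
typer seat gen 5 in the namespace of part 1 (`SahiDisjointSlot.lean`: L-disj `sahiE_cons_of_annihilating`, T′, …).
These are the elementary identities behind the identically-zero classes of the cube censuses of Sahi's `E_n`
(CENSUS.md §2/§5/§8); nothing here is a cited fact, everything is ours and elementary (the only printed ingredient is
the Lieb–Sahi recursion, tree `sahiE_cons` / `sahiE_snoc`).  No positivity or FKG hypothesis: identities for every
weight `μ`.

* (L1, every `n`) `sahiE_eq_zero_of_uncorrelated_pair_absorbed`: `E(xy) = E(x)E(y)` and every other slot absorbs `x`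
  and `y` ⇒ `E_{r+2}(x, y, G) = 0`.
* (L-thin, every `n`) `sahiE_update_thin`: a slot `z·h` with `z` factoring out of all mixed moments ⇒
  `E_n = E(z)·E_n(…, h, …)`.
* ABSORBED FREE SLOT `sahiE_cons_mul_absorbing_eq`: `E_{n+1}(x) = 0`, `g` absorbing every atom ⇒
  `E_{n+2}(h·g, x) = E_{n+2}(h, x)`.
* (L3-frame, `r = 1, 2`) `sahiE_absorbingFrame_one`, `sahiE_absorbingFrame_two`: `E_{n+1}(x) = 0`, `G`'s absorbing
  every atom, `H` free ⇒ `E_{n+3}(G, H, x) = ((n+2) − E G)·E_{n+2}(H, x)` and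
  `E_{n+4}(G₂, G₁, H, x) = [((n+2) − E(G₁G₂)) + ((n+2) − E G₁)((n+2) − E G₂)]·E_{n+2}(H, x)` (the census multipliers
  `3 − P(G)`, `4 − P(G)`, `(3 − P G₁)(3 − P G₂) + 3 − P(G₁ ∩ G₂)`).  The general-`r` cycle polynomial is part 3
  (`SahiAbsorbingFrame.lean`).
-/

namespace Summit.CriticalPhenomena.PercolationContinuityZ3.Theorems

namespace SahiIdentities

open MeasureTheory Finset Literature.Combinatorics.Sahi2008

noncomputable section

variable {α : Type*} [Fintype α]

/-- **(L1) an uncorrelated pair absorbed by every other slot, every `n`.** If `E(x y) = E(x) E(y)` and every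
`G i` absorbs `x` and `y` (`G i * x = x`, `G i * y = y`; events: `G_i ⊇ X ∪ Y` with `X`, `Y` uncorrelated),
then `E_{r+2}(x, y, G_0, …, G_{r-1}) = 0`.  Induction on `r`, peeling the last slot with the tree's `sahiE_snoc`:
every term of the recursion is again of this shape (`G_j * G_r` still absorbs `x` and `y`). OURS, elementary. -/
theorem sahiE_eq_zero_of_uncorrelated_pair_absorbed (μ : α → ℝ) (x y : α → ℝ)
    (hxy : ex μ (x * y) = ex μ x * ex μ y) :
    ∀ (r : ℕ) (G : Fin r → α → ℝ), (∀ i, G i * x = x) → (∀ i, G i * y = y) →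
      sahiE μ (r + 2) (Matrix.vecCons x (Matrix.vecCons y G)) = 0
  | 0, G, _, _ => by
      have hG : Matrix.vecCons x (Matrix.vecCons y G) = ![x, y] := by
        funext i
        refine Fin.cases ?_ (fun j => ?_) i
        · rfl
        · refine Fin.cases ?_ (fun k => k.elim0) j
          rfl
      rw [hG, sahiE_two, hxy, sub_self]
  | r + 1, G, hGx, hGy => by
      set g : α → ℝ := G (Fin.last r) with hg
      set F : Fin (r + 2) → α → ℝ := Matrix.vecCons x (Matrix.vecCons y (Fin.init G)) with hF
      have hsnoc : Matrix.vecCons x (Matrix.vecCons y G) = (Fin.snoc F g : Fin (r + 3) → α → ℝ) := by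
        rw [hF, hg]
        conv_lhs => rw [← Fin.snoc_init_self G]
        unfold Matrix.vecCons
        rw [Fin.cons_snoc_eq_snoc_cons, Fin.cons_snoc_eq_snoc_cons]
      have IH : ∀ (G' : Fin r → α → ℝ), (∀ i, G' i * x = x) → (∀ i, G' i * y = y) →
          sahiE μ (r + 2) (Matrix.vecCons x (Matrix.vecCons y G')) = 0 :=
        fun G' h1 h2 => sahiE_eq_zero_of_uncorrelated_pair_absorbed μ x y hxy r G' h1 h2
      have h0 : sahiE μ (r + 2) F = 0 := IH (Fin.init G) (fun i => hGx _) (fun i => hGy _)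
      rw [hsnoc, sahiE_snoc, h0, zero_mul, sub_zero]
      refine Finset.sum_eq_zero fun i _ => ?_
      refine Fin.cases ?_ (fun i' => ?_) i
      · -- slot `x`: `x * g = x`
        have hx0 : F 0 * g = F 0 := by
          rw [hF, Matrix.cons_val_zero, mul_comm]; exact hGx _
        rw [hx0, Function.update_eq_self]; exact h0
      · refine Fin.cases ?_ (fun j => ?_) i'
        · -- slot `y`
          have hy1 : F (Fin.succ 0) * g = F (Fin.succ 0) := by
            rw [hF, Matrix.cons_val_succ, Matrix.cons_val_zero, mul_comm]; exact hGy _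
          rw [hy1, Function.update_eq_self]; exact h0
        · -- slot `G j`: the updated family is again absorbing
          have hupd : Function.update F j.succ.succ (F j.succ.succ * g) =
              Matrix.vecCons x (Matrix.vecCons y (Function.update (Fin.init G) j (Fin.init G j * g))) := by
            rw [hF]
            funext i
            refine Fin.cases ?_ (fun i₁ => ?_) i
            · rw [Function.update_of_ne (Fin.succ_ne_zero _).symm, Matrix.cons_val_zero, Matrix.cons_val_zero]
            · refine Fin.cases ?_ (fun i₂ => ?_) i₁
              · rw [Function.update_of_ne (fun e => Fin.succ_ne_zero _ (Fin.succ_injective _ e).symm),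
                  Matrix.cons_val_succ, Matrix.cons_val_zero, Matrix.cons_val_succ, Matrix.cons_val_zero]
              · rw [Matrix.cons_val_succ, Matrix.cons_val_succ, Matrix.cons_val_succ, Matrix.cons_val_succ]
                by_cases hji : i₂ = j
                · subst hji
                  rw [Function.update_self, Function.update_self]
                · rw [Function.update_of_ne (fun e => hji (Fin.succ_injective _ (Fin.succ_injective _ e))),
                    Function.update_of_ne hji, Matrix.cons_val_succ, Matrix.cons_val_succ]
          rw [hupd]
          refine IH _ (fun i => ?_) (fun i => ?_)
          · by_cases hij : i = j
            · subst hij; rw [Function.update_self, mul_assoc, hGx]; exact hGx _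
            · rw [Function.update_of_ne hij]; exact hGx _
          · by_cases hij : i = j
            · subst hij; rw [Function.update_self, mul_assoc, hGy]; exact hGy _
            · rw [Function.update_of_ne hij]; exact hGy _

/-- **(L-thin) thinning a slot by an independent factor, every `n`.** If slot `k` holds `z * h` and `z` factors out
of every mixed moment with `h` and the other slots (`E(z·h·Π_S f) = E(z)·E(h·Π_S f)` for `S ∌ k`; events: `G = Z ∩ H`
with `Z` independent of `σ(H, all other arguments)`), then `E_n(…, z·h, …) = E(z) · E_n(…, h, …)`: positivity and the
zero locus survive thinning.  Two lines from the tree's `sahiE_update_congr_of_moments` + `sahiE_update_smul`. -/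
theorem sahiE_update_thin (μ : α → ℝ) {n : ℕ} (f : Fin n → α → ℝ) (k : Fin n) (z h : α → ℝ)
    (hind : ∀ S : Finset (Fin n), k ∉ S → ex μ (z * h * ∏ i ∈ S, f i) = ex μ z * ex μ (h * ∏ i ∈ S, f i)) :
    sahiE μ n (Function.update f k (z * h)) = ex μ z * sahiE μ n (Function.update f k h) := by
  rw [← sahiE_update_smul]
  refine sahiE_update_congr_of_moments μ f k fun S hS => ?_
  rw [hind S hS, smul_mul_assoc, ex_smul]

/-- **Absorbed factor in the free slot.** If `E_{n+1}(x) = 0` (e.g. `x` an independent family of `≥ 2` atoms) and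
`g` absorbs every `x i`, then `E_{n+2}(h·g, x) = E_{n+2}(h, x)` for every `h`: the difference is `E_{n+2}(h(g−1), x)`,
and `h(g−1)` annihilates every atom, so (L-disj₀) gives `−E_{n+1}(x)·E(h(g−1)) = 0`. OURS, elementary. -/
theorem sahiE_cons_mul_absorbing_eq (μ : α → ℝ) (n : ℕ) (h g : α → ℝ) (x : Fin (n + 1) → α → ℝ)
    (hx0 : sahiE μ (n + 1) x = 0) (hg : ∀ i, x i * g = x i) :
    sahiE μ (n + 2) (Matrix.vecCons (h * g) x) = sahiE μ (n + 2) (Matrix.vecCons h x) := by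
  have hd : ∀ i, x i * (h * g - h) = 0 := fun i => by
    linear_combination h * hg i
  have hsplit : Matrix.vecCons (h * g) x = Function.update (Matrix.vecCons h x) 0 (h + (h * g - h)) := by
    funext i
    refine Fin.cases ?_ (fun j => ?_) i
    · rw [Function.update_self, Matrix.cons_val_zero]
      ring
    · rw [Function.update_of_ne (Fin.succ_ne_zero j), Matrix.cons_val_succ, Matrix.cons_val_succ]
  have h1 : Function.update (Matrix.vecCons h x) 0 h = Matrix.vecCons h x := by
    funext i
    refine Fin.cases ?_ (fun j => ?_) i
    · rw [Function.update_self, Matrix.cons_val_zero]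
    · rw [Function.update_of_ne (Fin.succ_ne_zero j)]
  have h2 : Function.update (Matrix.vecCons h x) 0 (h * g - h) = Matrix.vecCons (h * g - h) x := by
    funext i
    refine Fin.cases ?_ (fun j => ?_) i
    · rw [Function.update_self, Matrix.cons_val_zero]
    · rw [Function.update_of_ne (Fin.succ_ne_zero j), Matrix.cons_val_succ, Matrix.cons_val_succ]
  rw [hsplit, sahiE_update_add, h1, h2, sahiE_cons_of_annihilating μ n (h * g - h) x hd, hx0]
  ring

/-- **(L3-frame, r = 1), every `m`.** If `E_{n+1}(x) = 0` and `G` absorbs every `x i` (NOT necessarily `H`), then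
`E_{n+3}(G, H, x) = ((n+2) − E G) · E_{n+2}(H, x)` — the Lieb–Sahi absorbing multiplier survives a free slot `H`
as soon as the frame `x` has `E_{n+1}(x) = 0`.  (`(m, r) = (2, 1)`: `3 − P(G)`; `(3, 1)`: `4 − P(G)`, the census
multipliers.)  Proof: the recursion `sahiE_cons` with head `G` + `sahiE_cons_mul_absorbing_eq`. OURS. -/
theorem sahiE_absorbingFrame_one (μ : α → ℝ) (n : ℕ) (G H : α → ℝ) (x : Fin (n + 1) → α → ℝ)
    (hx0 : sahiE μ (n + 1) x = 0) (hG : ∀ i, x i * G = x i) :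
    sahiE μ (n + 3) (Matrix.vecCons G (Matrix.vecCons H x)) =
      ((n + 2 : ℝ) - ex μ G) * sahiE μ (n + 2) (Matrix.vecCons H x) := by
  rw [sahiE_cons, Fin.sum_univ_succ]
  have h0 : Function.update (Matrix.vecCons H x) 0 (Matrix.vecCons H x 0 * G) = Matrix.vecCons (H * G) x := by
    funext i
    refine Fin.cases ?_ (fun j => ?_) i
    · rw [Function.update_self, Matrix.cons_val_zero, Matrix.cons_val_zero]
    · rw [Function.update_of_ne (Fin.succ_ne_zero j), Matrix.cons_val_succ, Matrix.cons_val_succ]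
  have hj : ∀ j : Fin (n + 1),
      Function.update (Matrix.vecCons H x) j.succ (Matrix.vecCons H x j.succ * G) = Matrix.vecCons H x := by
    intro j
    funext i
    refine Fin.cases ?_ (fun j' => ?_) i
    · rw [Function.update_of_ne (Fin.succ_ne_zero j).symm]
    · by_cases e : j' = j
      · subst e
        rw [Function.update_self, Matrix.cons_val_succ, hG]
      · rw [Function.update_of_ne (fun q => e (Fin.succ_injective _ q))]
  rw [h0, sahiE_cons_mul_absorbing_eq μ n H G x hx0 hG]
  simp only [hj, Finset.sum_const, Finset.card_univ, Fintype.card_fin, nsmul_eq_mul]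
  push_cast
  ring

/-- **(L3-frame, r = 2), every `m`.** With two slots `G₁, G₂` absorbing every atom of a frame `x` with
`E_{n+1}(x) = 0` and one free slot `H`:
`E_{n+4}(G₂, G₁, H, x) = [((n+2) − E(G₁G₂)) + ((n+2) − E G₁)((n+2) − E G₂)] · E_{n+2}(H, x)`
(`m = 2`: `(3 − P(G₁∩G₂)) + (3 − P G₁)(3 − P G₂)`, the census multiplier).  Same recursion, head `G₂`. OURS. -/
theorem sahiE_absorbingFrame_two (μ : α → ℝ) (n : ℕ) (G₁ G₂ H : α → ℝ) (x : Fin (n + 1) → α → ℝ)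
    (hx0 : sahiE μ (n + 1) x = 0) (hG₁ : ∀ i, x i * G₁ = x i) (hG₂ : ∀ i, x i * G₂ = x i) :
    sahiE μ (n + 4) (Matrix.vecCons G₂ (Matrix.vecCons G₁ (Matrix.vecCons H x))) =
      (((n + 2 : ℝ) - ex μ (G₁ * G₂)) + ((n + 2 : ℝ) - ex μ G₁) * ((n + 2 : ℝ) - ex μ G₂)) *
        sahiE μ (n + 2) (Matrix.vecCons H x) := by
  rw [sahiE_cons, Fin.sum_univ_succ, Fin.sum_univ_succ]
  have hG12 : ∀ i, x i * (G₁ * G₂) = x i := fun i => by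
    rw [← mul_assoc, hG₁ i, hG₂ i]
  set F : Fin (n + 3) → α → ℝ := Matrix.vecCons G₁ (Matrix.vecCons H x) with hF
  have h0 : Function.update F 0 (F 0 * G₂) = Matrix.vecCons (G₁ * G₂) (Matrix.vecCons H x) := by
    rw [hF]
    funext i
    refine Fin.cases ?_ (fun j => ?_) i
    · rw [Function.update_self, Matrix.cons_val_zero, Matrix.cons_val_zero]
    · rw [Function.update_of_ne (Fin.succ_ne_zero j), Matrix.cons_val_succ, Matrix.cons_val_succ]
  have h1 : Function.update F (Fin.succ 0) (F (Fin.succ 0) * G₂) =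
      Matrix.vecCons G₁ (Matrix.vecCons (H * G₂) x) := by
    rw [hF]
    funext i
    refine Fin.cases ?_ (fun j => ?_) i
    · rw [Function.update_of_ne (Fin.succ_ne_zero _).symm, Matrix.cons_val_zero, Matrix.cons_val_zero]
    · refine Fin.cases ?_ (fun j₂ => ?_) j
      · rw [Function.update_self, Matrix.cons_val_succ, Matrix.cons_val_zero, Matrix.cons_val_succ,
          Matrix.cons_val_zero]
      · rw [Function.update_of_ne (fun q => Fin.succ_ne_zero _ (Fin.succ_injective _ q)),
          Matrix.cons_val_succ, Matrix.cons_val_succ, Matrix.cons_val_succ, Matrix.cons_val_succ]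
  have hj : ∀ j : Fin (n + 1), Function.update F j.succ.succ (F j.succ.succ * G₂) = F := by
    intro j
    rw [hF]
    funext i
    refine Fin.cases ?_ (fun i₁ => ?_) i
    · rw [Function.update_of_ne (Fin.succ_ne_zero _).symm]
    · refine Fin.cases ?_ (fun i₂ => ?_) i₁
      · rw [Function.update_of_ne (fun q => Fin.succ_ne_zero _ (Fin.succ_injective _ q).symm)]
      · by_cases e : i₂ = j
        · subst e
          rw [Function.update_self, Matrix.cons_val_succ, Matrix.cons_val_succ, hG₂]
        · rw [Function.update_of_ne (fun q => e (Fin.succ_injective _ (Fin.succ_injective _ q)))]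
  rw [h0, h1, sahiE_absorbingFrame_one μ n (G₁ * G₂) H x hx0 hG12,
    sahiE_absorbingFrame_one μ n G₁ (H * G₂) x hx0 hG₁, sahiE_cons_mul_absorbing_eq μ n H G₂ x hx0 hG₂]
  simp only [hj, Finset.sum_const, Finset.card_univ, Fintype.card_fin, nsmul_eq_mul]
  rw [hF, sahiE_absorbingFrame_one μ n G₁ H x hx0 hG₁]
  push_cast
  ring

end

end SahiIdentities

end Summit.CriticalPhenomena.PercolationContinuityZ3.Theorems
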